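import Summits.NavierStokesRegularity.NavierStokesRegularity.Theorems.WakeRatchetEternalInviscidRateConveyorFlux

/-!
# Conveyor ledger (crux `WakeRatchet.EternalInviscidRate`, ⟨stmt-NavierStokesRegularity-25646⟩) —
# THE LEAK RATCHET: `Θ_{n+1} ≤ (1 − e^{−2C_AΛ⁻¹A_{n+1}})·Θ_n` for EVERY bounded admissible inviscid eternal solution,
# hence NO CONVEYOR and FADING PEAKS unconditionally (`stub_noConveyor`'s inner conclusion holds on the whole class)

For a uniformly bounded admissible INVISCID eternal solution `W` of a cancelling table (`m = 4`, any `ε₀ > 0`) write `T_n(σ) = Σ_{k≥n} E_k(σ)`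
for the physical tail energies (finite, `T_n' = F_{n−1}`, landed `hasDerivAt_finalTail`), `Θ` for any bound of `T_n`, and
`A ≥ ∫_ℝ ‖W_{n+1}‖` (finite by the ACTION clause of `IsEternal`; `c := 2C_AΛ⁻¹`).
* `tail_succ_le_leak` — THE LEAK RATCHET: for `σ₀ ≤ σ`, `T_{n+1}(σ) ≤ (1 − e^{−cA})·Θ + e^{−cA}·T_{n+1}(σ₀)`.
  PROOF: `K(s) := (Θ − T_{n+1}(s))·exp(∫_{σ₀}^{s} c‖W_{n+1}‖)` is non-decreasing, because `K'·e^{−∫} = −F_n + c‖W_{n+1}‖(Θ − T_{n+1})` and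
  `F_n ≤ |F_n| ≤ c‖W_{n+1}‖·E_n ≤ c‖W_{n+1}‖·(T_n − T_{n+1}) ≤ c‖W_{n+1}‖·(Θ − T_{n+1})` (landed `abs_physFlux_le`: the flux through a bond
  is controlled by the energy BELOW it times the amplitude ABOVE it).  So the DEFICIT `Θ − T_{n+1}` below the envelope can shrink by at most
  the factor `e^{−cA}` over all time: the shell above `n` can never hold more than the fraction `1 − e^{−cA}` of the envelope.
* `tail_succ_le_leak_envelope` — letting `σ₀ → −∞` (`T_{n+1}(σ₀) → 0`): `T_{n+1}(σ) ≤ (1 − e^{−cA})·Θ` for all `σ`; with the uniform action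
  bound `M`: `sup_σ T_{n+1} ≤ (1 − e^{−cM})·sup_σ T_n` — the TAIL RATCHET of the route's aside crux `TailRatchet` (stmt-21808) holds for
  EVERY solution with the SOLUTION-DEPENDENT fraction `w = e^{−2C_AΛ⁻¹M}` (the crux asks `w = w(R)` uniform; on K41 fronts `M ~ 1/ε₀`, so
  this does not touch the rate cruxes — it is the qualitative skeleton of the wake-floor mechanism, kernel-certified).
* `tail_le_leak_pow` — iterating: `T_{n+j}(σ) ≤ (1 − e^{−cM})^j·Θ` for all `j, σ`.
* `noConveyor_all` — hence EVERY final tail is the sum of the final wakes above it (`L n = Σ_k ω(n+k)`): the inner conclusion of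
  `stub_noConveyor` holds for EVERY uniformly bounded admissible inviscid eternal solution of EVERY cancelling table at EVERY `ε₀ > 0`
  (conveyor mass `m ≤ L(n+j) ≤ (1−e^{−cM})^jΘ → 0`).  Only the skeleton-local name `NoConveyor` (planner folder) separates this from a
  by-name close of the stub.
* `peaksFade_all` — and single-shell peaks fade: `∀ δ > 0 ∃ n ∀ σ, E_n(σ) ≤ δ` (g0's residual «PeaksFade» is a THEOREM).
MODEL lattice only (Tao 2016 §4 renormalised cascade); nothing here is a statement about the Navier–Stokes equations, no stub is closed by name,
no summit is proved by this file.
[cite: Tao2016AveragedNS, §4 Lemma 4.1 (4.8)–(4.10) with the cancellation (4.3), in the self-similar variables of §6.4]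
-/

noncomputable section

set_option linter.dupNamespace false

open Filter Topology Set MeasureTheory
open Literature.Analysis.FluidPDE Literature.Analysis.FluidPDE.TaoCascade
open Summit.NavierStokesRegularity.NavierStokesRegularity.Theorems

namespace Summit.NavierStokesRegularity.NavierStokesRegularity.Cruxes.EternalInviscidRate.FinalWakeLedger

variable {ε₀ : ℝ} {α : Fin 4 → Fin 4 → Fin 4 → ℤ × ℤ × ℤ → ℝ} {W : ℤ → ℝ → Em 4}

/-- **THE LEAK RATCHET.**  For a uniformly bounded admissible inviscid eternal solution of a cancelling table (`ε₀ > 0`), a shell `n` whose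
tail is bounded by `Θ` at all log-times, `∫_ℝ ‖W_{n+1}‖ ≤ A`, and `σ₀ ≤ σ`:
`T_{n+1}(σ) ≤ (1 − e^{−2C_AΛ⁻¹A})·Θ + e^{−2C_AΛ⁻¹A}·T_{n+1}(σ₀)`.  MODEL lattice only.
[cite: Tao2016AveragedNS, §4 Lemma 4.1 (4.8)–(4.10) with the cancellation (4.3), §6.4] -/
theorem tail_succ_le_leak (hε : 0 < ε₀) (hc : IsCancellingCoeff α) (hW : IsEternal ε₀ α W) (hU : UniformBound W)
    (n : ℤ) {Θ : ℝ} (hΘ : ∀ σ : ℝ, ∑' k : ℕ, physEnergy ε₀ W (n + k) σ ≤ Θ)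
    {A : ℝ} (hint : Integrable (fun σ => ‖W (n + 1) σ‖)) (hA : ∫ σ, ‖W (n + 1) σ‖ ≤ A)
    {σ₀ σ : ℝ} (hσ : σ₀ ≤ σ) :
    ∑' k : ℕ, physEnergy ε₀ W (n + 1 + k) σ ≤
      (1 - Real.exp (-(2 * fluxConst α * (bigLam ε₀)⁻¹ * A))) * Θ
        + Real.exp (-(2 * fluxConst α * (bigLam ε₀)⁻¹ * A)) * ∑' k : ℕ, physEnergy ε₀ W (n + 1 + k) σ₀ := by
  have hΛ : 0 < bigLam ε₀ := bigLam_pos (by linarith)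
  have hS : ∀ (n : ℤ) (σ : ℝ), Summable (fun k : ℕ => physEnergy ε₀ W (n + k) σ) :=
    summable_physEnergy_tail_cm hε hU
  set c : ℝ := 2 * fluxConst α * (bigLam ε₀)⁻¹ with hc_def
  have hc0 : 0 ≤ c := by have := fluxConst_nonneg α; rw [hc_def]; positivity
  -- the tail above `n+1`, the energy of shell `n`, and `T_n = E_n + T_{n+1}`
  set T1 : ℝ → ℝ := fun s => ∑' k : ℕ, physEnergy ε₀ W (n + 1 + k) s with hT1
  have hsplit : ∀ s, ∑' k : ℕ, physEnergy ε₀ W (n + k) s = physEnergy ε₀ W n s + T1 s := by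
    intro s
    have h := (hS n s).sum_add_tsum_nat_add 1
    have e : (fun k : ℕ => physEnergy ε₀ W (n + ((k + 1 : ℕ) : ℤ)) s) = fun k : ℕ => physEnergy ε₀ W (n + 1 + k) s := by
      funext k; push_cast; ring_nf
    rw [e, Finset.sum_range_one] at h
    simpa using h.symm
  -- the deficit `Θ − T_{n+1}` dominates `E_n`
  have hdef : ∀ s, physEnergy ε₀ W n s ≤ Θ - T1 s := by
    intro s; have := hΘ s; rw [hsplit s] at this; linarith
  have hdef0 : ∀ s, 0 ≤ Θ - T1 s := fun s => (physEnergy_nonneg _ _ _ _).trans (hdef s)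
  -- `T_{n+1}' = F_n`
  have hT1d : ∀ s, HasDerivAt T1 (physFlux ε₀ α W n s) s := by
    intro s
    have h := hasDerivAt_finalTail hε hc hW hU (n + 1) s
    rwa [add_sub_cancel_right] at h
  -- the leak rate `a = c‖W_{n+1}‖`, `F_n ≤ a·(Θ − T_{n+1})`
  set a : ℝ → ℝ := fun s => c * ‖W (n + 1) s‖ with ha
  have ha0 : ∀ s, 0 ≤ a s := fun s => mul_nonneg hc0 (norm_nonneg _)
  have hFle : ∀ s, physFlux ε₀ α W n s ≤ a s * (Θ - T1 s) := by
    intro s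
    have h := abs_physFlux_le hε hc W n s
    calc physFlux ε₀ α W n s ≤ |physFlux ε₀ α W n s| := le_abs_self _
      _ ≤ 2 * fluxConst α * (bigLam ε₀)⁻¹ * ‖W (n + 1) s‖ * physEnergy ε₀ W n s := h
      _ = a s * physEnergy ε₀ W n s := by rw [ha]
      _ ≤ a s * (Θ - T1 s) := mul_le_mul_of_nonneg_left (hdef s) (ha0 s)
  -- `a` continuous, integrable, `∫_{σ₀}^{s} a ≤ cA` for `s ≥ σ₀`
  have hcontW : Continuous (fun s : ℝ => ‖W (n + 1) s‖) :=
    (continuous_iff_continuousAt.2 fun s => (hW.law (n + 1) s).continuousAt).norm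
  have hcont_a : Continuous a := continuous_const.mul hcontW
  have hint_a : Integrable a := hint.const_mul c
  set I : ℝ → ℝ := fun s => ∫ u in σ₀..s, a u with hI
  have hId : ∀ s, HasDerivAt I (a s) s := fun s => (hcont_a.integral_hasStrictDerivAt σ₀ s).hasDerivAt
  have hIle : I σ ≤ c * A := by
    simp only [hI]
    rw [intervalIntegral.integral_of_le hσ]
    calc ∫ u in Ioc σ₀ σ, a u ≤ ∫ u, a u := setIntegral_le_integral hint_a (Eventually.of_forall ha0)
      _ = c * ∫ u, ‖W (n + 1) u‖ := integral_const_mul _ _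
      _ ≤ c * A := mul_le_mul_of_nonneg_left hA hc0
  -- the monotone functional `K = (Θ − T_{n+1})·e^{I}`
  set K : ℝ → ℝ := fun s => (Θ - T1 s) * Real.exp (I s) with hK
  have hKd : ∀ s, HasDerivAt K (-physFlux ε₀ α W n s * Real.exp (I s) + (Θ - T1 s) * (Real.exp (I s) * a s)) s :=
    fun s => ((hT1d s).const_sub Θ).mul (hId s).exp
  have hK' : ∀ s, 0 ≤ deriv K s := by
    intro s
    rw [(hKd s).deriv]
    have hexp : 0 < Real.exp (I s) := Real.exp_pos _
    have e : -physFlux ε₀ α W n s * Real.exp (I s) + (Θ - T1 s) * (Real.exp (I s) * a s)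
        = (a s * (Θ - T1 s) - physFlux ε₀ α W n s) * Real.exp (I s) := by ring
    rw [e]
    exact mul_nonneg (by linarith [hFle s]) hexp.le
  have hKmono : Monotone K := monotone_of_deriv_nonneg (fun s => (hKd s).differentiableAt) hK'
  -- `Θ − T_{n+1}(σ₀) = K σ₀ ≤ K σ ≤ (Θ − T_{n+1}(σ))·e^{cA}`
  have hK0 : K σ₀ = Θ - T1 σ₀ := by simp [hK, hI, intervalIntegral.integral_same]
  have h1 : Θ - T1 σ₀ ≤ (Θ - T1 σ) * Real.exp (c * A) := by
    have h := hKmono hσ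
    rw [hK0] at h
    exact h.trans (mul_le_mul_of_nonneg_left (Real.exp_le_exp.2 hIle) (hdef0 σ))
  -- multiply by `e^{−cA}`
  have hecA : Real.exp (c * A) * Real.exp (-(c * A)) = 1 := by
    rw [← Real.exp_add, add_neg_cancel, Real.exp_zero]
  have hw0 : 0 < Real.exp (-(c * A)) := Real.exp_pos _
  have h3 : (Θ - T1 σ₀) * Real.exp (-(c * A)) ≤ Θ - T1 σ := by
    have h4 := mul_le_mul_of_nonneg_right h1 hw0.le
    calc (Θ - T1 σ₀) * Real.exp (-(c * A)) ≤ (Θ - T1 σ) * Real.exp (c * A) * Real.exp (-(c * A)) := h4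
      _ = (Θ - T1 σ) * (Real.exp (c * A) * Real.exp (-(c * A))) := by ring
      _ = Θ - T1 σ := by rw [hecA, mul_one]
  show T1 σ ≤ (1 - Real.exp (-(c * A))) * Θ + Real.exp (-(c * A)) * T1 σ₀
  linarith [h3]

/-- **The leak ratchet, envelope form.**  Under the same hypotheses, `T_{n+1}(σ) ≤ (1 − e^{−2C_AΛ⁻¹A})·Θ` for EVERY `σ`
(`σ₀ → −∞`: tails vanish in the far past).  MODEL lattice only.
[cite: Tao2016AveragedNS, §4 Lemma 4.1 (4.8)–(4.10) with the cancellation (4.3), §6.4] -/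
theorem tail_succ_le_leak_envelope (hε : 0 < ε₀) (hc : IsCancellingCoeff α) (hW : IsEternal ε₀ α W) (hU : UniformBound W)
    (n : ℤ) {Θ : ℝ} (hΘ : ∀ σ : ℝ, ∑' k : ℕ, physEnergy ε₀ W (n + k) σ ≤ Θ)
    {A : ℝ} (hint : Integrable (fun σ => ‖W (n + 1) σ‖)) (hA : ∫ σ, ‖W (n + 1) σ‖ ≤ A) (σ : ℝ) :
    ∑' k : ℕ, physEnergy ε₀ W (n + 1 + k) σ ≤ (1 - Real.exp (-(2 * fluxConst α * (bigLam ε₀)⁻¹ * A))) * Θ := by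
  set q : ℝ := Real.exp (-(2 * fluxConst α * (bigLam ε₀)⁻¹ * A)) with hq
  have hbot : Tendsto (fun σ₀ => ∑' k : ℕ, physEnergy ε₀ W (n + 1 + k) σ₀) atBot (𝓝 0) :=
    tendsto_finalTail_atBot hε hU (n + 1)
  have hlim : Tendsto (fun σ₀ => (1 - q) * Θ + q * ∑' k : ℕ, physEnergy ε₀ W (n + 1 + k) σ₀) atBot
      (𝓝 ((1 - q) * Θ + q * 0)) := tendsto_const_nhds.add (hbot.const_mul q)
  rw [mul_zero, add_zero] at hlim
  refine ge_of_tendsto hlim ?_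
  filter_upwards [eventually_le_atBot σ] with σ₀ hσ₀
  exact tail_succ_le_leak hε hc hW hU n hΘ hint hA hσ₀

/-- **Iterated leak ratchet.**  With the uniform action bound `M` of `IsEternal` (`∫_ℝ ‖W_k‖ ≤ M` for every shell): if the tail above `n`
is `≤ Θ` at all log-times, then the tail above `n + j` is `≤ (1 − e^{−2C_AΛ⁻¹M})^j·Θ` at all log-times.  MODEL lattice only.
[cite: Tao2016AveragedNS, §4 Lemma 4.1 (4.8)–(4.10) with the cancellation (4.3), §6.4] -/
theorem tail_le_leak_pow (hε : 0 < ε₀) (hc : IsCancellingCoeff α) (hW : IsEternal ε₀ α W) (hU : UniformBound W)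
    {M : ℝ} (hM : ∀ k : ℤ, Integrable (fun σ => ‖W k σ‖) ∧ ∫ σ, ‖W k σ‖ ≤ M)
    (n : ℤ) {Θ : ℝ} (hΘ : ∀ σ : ℝ, ∑' k : ℕ, physEnergy ε₀ W (n + k) σ ≤ Θ) (j : ℕ) (σ : ℝ) :
    ∑' k : ℕ, physEnergy ε₀ W (n + j + k) σ ≤ (1 - Real.exp (-(2 * fluxConst α * (bigLam ε₀)⁻¹ * M))) ^ j * Θ := by
  induction j generalizing σ with
  | zero => simpa using hΘ σ
  | succ j ih =>
    have h := tail_succ_le_leak_envelope hε hc hW hU (n + j) (Θ := (1 - Real.exp (-(2 * fluxConst α * (bigLam ε₀)⁻¹ * M))) ^ j * Θ)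
      ih (hM (n + j + 1)).1 (hM (n + j + 1)).2 σ
    have e : (n : ℤ) + ((j + 1 : ℕ) : ℤ) = n + j + 1 := by push_cast; ring
    rw [e, pow_succ]
    linarith

/-- **NO CONVEYOR — `stub_noConveyor`'s inner conclusion for EVERY bounded admissible inviscid eternal solution.**  For a uniformly
bounded admissible inviscid eternal solution of a cancelling table (`m = 4`, any `ε₀ > 0`) with final wakes `ω` and final tails `L`
(landed `stub_wakeLimit` / `stub_tailLimit`), every final tail equals the sum of the final wakes above it: `L n = Σ_k ω(n+k)`.
MODEL lattice only.  [cite: Tao2016AveragedNS, §4 Lemma 4.1 (4.8)–(4.10) with the cancellation (4.3), §6.4] -/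
theorem noConveyor_all (hε : 0 < ε₀) (hc : IsCancellingCoeff α) (hW : IsEternal ε₀ α W) (hU : UniformBound W)
    {ω : ℤ → ℝ} (hω : ∀ k : ℤ, Tendsto (physEnergy ε₀ W k) atTop (𝓝 (ω k)))
    {L : ℤ → ℝ} (hL : ∀ n : ℤ, Tendsto (fun σ => ∑' k : ℕ, physEnergy ε₀ W (n + k) σ) atTop (𝓝 (L n)))
    (n : ℤ) : L n = ∑' k : ℕ, ω (n + k) := by
  obtain ⟨M, hM⟩ := hW.action
  have hS : ∀ (n : ℤ) (σ : ℝ), Summable (fun k : ℕ => physEnergy ε₀ W (n + k) σ) :=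
    summable_physEnergy_tail_cm hε hU
  obtain ⟨Θ, hΘ⟩ := finalTail_globally_bdd hε hU n (hL n)
  have hΘ0 : 0 ≤ Θ := le_trans (tsum_nonneg fun k => physEnergy_nonneg _ _ _ _) (hΘ 0)
  set q : ℝ := 1 - Real.exp (-(2 * fluxConst α * (bigLam ε₀)⁻¹ * M)) with hq
  have hq0 : 0 ≤ q := by rw [hq]; linarith [Real.exp_le_one_iff.2 (show -(2 * fluxConst α * (bigLam ε₀)⁻¹ * M) ≤ 0 from by
    have := fluxConst_nonneg α
    have hΛ : 0 < bigLam ε₀ := bigLam_pos (by linarith)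
    have hM0 : 0 ≤ M := le_trans (integral_nonneg fun σ => norm_nonneg _) ((hM 0).2)
    have : 0 ≤ 2 * fluxConst α * (bigLam ε₀)⁻¹ * M := by positivity
    linarith)]
  have hq1 : q < 1 := by rw [hq]; linarith [Real.exp_pos (-(2 * fluxConst α * (bigLam ε₀)⁻¹ * M))]
  -- the conveyor mass is at most every final tail `L (n+j) ≤ q^j Θ`
  have hm : ∀ j : ℕ, conveyorMass ω L n ≤ q ^ j * Θ := by
    intro j
    have hLj : L (n + j) ≤ q ^ j * Θ :=
      le_of_tendsto' (hL (n + j)) fun σ => tail_le_leak_pow hε hc hW hU hM n hΘ j σ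
    have hωj : 0 ≤ ∑' k : ℕ, ω (n + j + k) := tsum_nonneg fun k => finalWake_nonneg hω _
    rw [conveyorMass_const hS hω hL n (n + j)]
    unfold conveyorMass
    linarith
  have hpow : Tendsto (fun j : ℕ => q ^ j * Θ) atTop (𝓝 (0 * Θ)) :=
    (tendsto_pow_atTop_nhds_zero_of_lt_one hq0 hq1).mul_const Θ
  rw [zero_mul] at hpow
  have hm0 : conveyorMass ω L n ≤ 0 := ge_of_tendsto hpow (Eventually.of_forall hm)
  have hm0' : 0 ≤ conveyorMass ω L n := conveyorMass_nonneg hS hω hL n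
  have hmz : conveyorMass ω L n = 0 := le_antisymm hm0 hm0'
  unfold conveyorMass at hmz
  linarith

/-- **PEAKS FADE — for every bounded admissible inviscid eternal solution.**  For every `δ > 0` some shell's physical energy stays `≤ δ` at
all log-times (indeed every shell `n + j` with `(1−e^{−cM})^j·Θ_n ≤ δ`).  MODEL lattice only.
[cite: Tao2016AveragedNS, §4 Lemma 4.1 (4.8)–(4.10) with the cancellation (4.3), §6.4] -/
theorem peaksFade_all (hε : 0 < ε₀) (hc : IsCancellingCoeff α) (hW : IsEternal ε₀ α W) (hU : UniformBound W)
    {L : ℤ → ℝ} (hL : ∀ n : ℤ, Tendsto (fun σ => ∑' k : ℕ, physEnergy ε₀ W (n + k) σ) atTop (𝓝 (L n)))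
    {δ : ℝ} (hδ : 0 < δ) : ∃ n : ℤ, ∀ σ : ℝ, physEnergy ε₀ W n σ ≤ δ := by
  obtain ⟨M, hM⟩ := hW.action
  obtain ⟨Θ, hΘ⟩ := finalTail_globally_bdd hε hU 0 (hL 0)
  set q : ℝ := 1 - Real.exp (-(2 * fluxConst α * (bigLam ε₀)⁻¹ * M)) with hq
  have hq0 : 0 ≤ q := by rw [hq]; linarith [Real.exp_le_one_iff.2 (show -(2 * fluxConst α * (bigLam ε₀)⁻¹ * M) ≤ 0 from by
    have := fluxConst_nonneg α
    have hΛ : 0 < bigLam ε₀ := bigLam_pos (by linarith)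
    have hM0 : 0 ≤ M := le_trans (integral_nonneg fun σ => norm_nonneg _) ((hM 0).2)
    have : 0 ≤ 2 * fluxConst α * (bigLam ε₀)⁻¹ * M := by positivity
    linarith)]
  have hq1 : q < 1 := by rw [hq]; linarith [Real.exp_pos (-(2 * fluxConst α * (bigLam ε₀)⁻¹ * M))]
  have hpow : Tendsto (fun j : ℕ => q ^ j * Θ) atTop (𝓝 (0 * Θ)) :=
    (tendsto_pow_atTop_nhds_zero_of_lt_one hq0 hq1).mul_const Θ
  rw [zero_mul] at hpow
  obtain ⟨j, hj⟩ : ∃ j : ℕ, q ^ j * Θ < δ := ((tendsto_order.1 hpow).2 δ hδ).exists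
  refine ⟨(0 : ℤ) + j, fun σ => ?_⟩
  have h1 : physEnergy ε₀ W ((0 : ℤ) + j) σ ≤ ∑' k : ℕ, physEnergy ε₀ W ((0 : ℤ) + j + k) σ :=
    WakeRatchetTail.physEnergy_le_tail hε hU _ σ
  have h2 := tail_le_leak_pow hε hc hW hU hM 0 hΘ j σ
  linarith

end Summit.NavierStokesRegularity.NavierStokesRegularity.Cruxes.EternalInviscidRate.FinalWakeLedger

end
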